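import Mathlib
import Summits.Ventures.PercRepro2.Defs
import Summits.Ventures.PercRepro2.Independence
import Summits.Ventures.PercRepro2.Harris
import Summits.Ventures.PercRepro2.Graph
import Summits.Ventures.PercRepro2.Events
import Summits.Ventures.PercRepro2.ZCClusterBlind
import Summits.Ventures.PercRepro2.ZCRootDecomp
import Summits.Ventures.PercRepro2.ZCCondProb
import Summits.Ventures.PercRepro2.ZCThetaPA
import Summits.Ventures.PercRepro2.CondAvoidPA
import Summits.Ventures.PercRepro2.ZCDirectCube
import Summits.Ventures.PercRepro2.ZCDirectFibre
import Summits.Ventures.PercRepro2.ZCDirectInfluence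

/-!
# `(ZC-direct)` for functions: the influence of the root edges for a monotone observable of the
attachments (blind cell PercRepro2, mine-a g29)

The functional version of part 2: for a monotone `u : (edges of a₁ → Bool) → R` with values in `[0, 1]`,
the influence `I_u(C) = E[u] − E[u ∘ clear_C]` (`IpropF`), its cluster-property form `fIu v ω = I_u(C_ω(v))`
(`isMonotoneClusterProperty_fIu`), the factorisation `E[u·1_{Xᶜ}] = P(Xᶜ)·E[u ∘ clear]` over the split of
the edges of `a₁` into those into `C'(a₃)` and the rest (`expect_mul_indicator_compl_eq`), and the
fibre covariance identity `E[u 1_X] − E[u] P(X) = P(Xᶜ)·I_u(C'(a₃))` (`fib_cov_eq_fun`).  Used by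
`ZCDirectFunMain` (the theorem `zc_direct_fun`) and by the `N`-first split of the cluster-blind form
(MINE-A.md §83.6).
-/

namespace Summit.Ventures.PercRepro2

namespace ZCDirect

variable {V : Type*} {E : Type*} [Fintype V] [DecidableEq V] [Fintype E] [DecidableEq E]
  {R : Type*} [Field R] [LinearOrder R] [IsStrictOrderedRing R]

variable (ends : E → Sym2 V) (a₁ : V)

section Fun

variable (p : E → R)

/-- The influence of the edges into `C` on a monotone observable `u` of the attachments. -/
noncomputable def IpropF (u : ({e // e ∉ awayEdges ends a₁} → Bool) → R) (C : Set V) : R :=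
  expect (fun i : {e // e ∉ awayEdges ends a₁} => p i) u -
    expect (fun i : {e // e ∉ awayEdges ends a₁} => p i) (fun τ => u (clearInto ends a₁ C τ))

/-- The influence as a cluster property: `I_u(C(v))`. -/
noncomputable def fIu (u : ({e // e ∉ awayEdges ends a₁} → Bool) → R) : V → Config E → R :=
  fun v ω => IpropF ends a₁ p u (cluster ends ω v)

/-- `0 ≤ I_u` for monotone `u`. -/
lemma IpropF_nonneg (hp : IsProbVec p) {u : ({e // e ∉ awayEdges ends a₁} → Bool) → R}
    (hu : Monotone u) (C : Set V) : 0 ≤ IpropF ends a₁ p u C := by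
  unfold IpropF
  rw [sub_nonneg]
  exact expect_mono (isProbVec_restrict ends a₁ hp) fun τ => hu (clearInto_le ends a₁ C τ)

/-- `I_u ≤ 1` for `0 ≤ u ≤ 1`. -/
lemma IpropF_le_one (hp : IsProbVec p) {u : ({e // e ∉ awayEdges ends a₁} → Bool) → R}
    (hu0 : ∀ τ, 0 ≤ u τ) (hu1 : ∀ τ, u τ ≤ 1) (C : Set V) : IpropF ends a₁ p u C ≤ 1 := by
  unfold IpropF
  have h1 : expect (fun i : {e // e ∉ awayEdges ends a₁} => p i) u ≤ 1 := by
    have := expect_mono (isProbVec_restrict ends a₁ hp) hu1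
    rwa [expect_const] at this
  have h2 := expect_nonneg (isProbVec_restrict ends a₁ hp) fun τ => hu0 (clearInto ends a₁ C τ)
  linarith

/-- `I_u` is monotone in the cluster. -/
lemma IpropF_mono (hp : IsProbVec p) {u : ({e // e ∉ awayEdges ends a₁} → Bool) → R}
    (hu : Monotone u) {C C' : Set V} (h : C ⊆ C') :
    IpropF ends a₁ p u C ≤ IpropF ends a₁ p u C' := by
  unfold IpropF
  have := expect_mono (isProbVec_restrict ends a₁ hp) fun τ => hu (clearInto_anti ends a₁ h τ)
  linarith

/-- `fIu` is a monotone cluster property. -/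
lemma isMonotoneClusterProperty_fIu (hp : IsProbVec p)
    {u : ({e // e ∉ awayEdges ends a₁} → Bool) → R} (hu : Monotone u) :
    IsMonotoneClusterProperty ends (fIu ends a₁ p u) where
  mono := fun _ _ _ h => IpropF_mono ends a₁ p hp hu h
  eq_of_openAdj := fun _ _ _ h => by
    unfold fIu
    rw [cluster_eq_of_conn (conn_of_openAdj h)]

omit [Fintype V] [DecidableEq V] [Fintype E] [DecidableEq E] [LinearOrder R] [IsStrictOrderedRing R] in
/-- `clearInto C` of a configuration glued along `into C` closes exactly the first component. -/
lemma clearInto_glue (C : Set V) [DecidablePred (· ∈ into ends a₁ C)]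
    (σ : {i // i ∈ into ends a₁ C} → Bool) (σ' : {i // i ∉ into ends a₁ C} → Bool) :
    clearInto ends a₁ C (glue (into ends a₁ C) σ σ') =
      glue (into ends a₁ C) (fun _ => false) σ' := by
  funext e
  unfold clearInto
  by_cases he : e ∈ into ends a₁ C
  · rw [if_pos he, glue_apply_of_mem _ _ _ he]
  · rw [if_neg he, glue_apply_of_notMem _ _ _ he, glue_apply_of_notMem _ _ _ he]

omit [LinearOrder R] [IsStrictOrderedRing R] in
/-- **Factorisation**: `E[u · 1_{Xᶜ}] = P(Xᶜ) · E[u ∘ clear_{C'(a₃)}]` for `X = {a₁ ↔ a₃}`'s fibre. -/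
lemma expect_mul_indicator_compl_eq (u : ({e // e ∉ awayEdges ends a₁} → Bool) → R)
    (σ₁ : {e // e ∈ awayEdges ends a₁} → Bool) {a₃ : V} (h3 : a₃ ≠ a₁) :
    expect (fun i : {e // e ∉ awayEdges ends a₁} => p i)
        (fun τ => u τ * (fib ends a₁ (connEvent ends a₁ a₃) σ₁)ᶜ.indicator 1 τ) =
      prob (fun i : {e // e ∉ awayEdges ends a₁} => p i) (fib ends a₁ (connEvent ends a₁ a₃) σ₁)ᶜ *
        expect (fun i : {e // e ∉ awayEdges ends a₁} => p i)
          (fun τ => u (clearInto ends a₁ (cluster ends (baseConfig ends a₁ σ₁) a₃) τ)) := by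
  classical
  set p₂ : {e // e ∉ awayEdges ends a₁} → R := fun i => p i
  set C := cluster ends (baseConfig ends a₁ σ₁) a₃
  set F₂ : Set {e // e ∉ awayEdges ends a₁} := into ends a₁ C
  set X := fib ends a₁ (connEvent ends a₁ a₃) σ₁
  -- the raw identity for any `v`: `E[v · 1_{Xᶜ}] = w(0) · ∑_{σ'} w(σ') v(glue 0 σ')`
  have raw : ∀ v : ({e // e ∉ awayEdges ends a₁} → Bool) → R,
      expect p₂ (fun τ => v τ * Xᶜ.indicator 1 τ) =
        weight (fun i : {i // i ∈ F₂} => p₂ i) (fun _ => false) *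
          ∑ σ' : {i // i ∉ F₂} → Bool, weight (fun i : {i // i ∉ F₂} => p₂ i) σ' *
            v (glue F₂ (fun _ => false) σ') := by
    intro v
    rw [expect_eq_sum_glue p₂ _ F₂]
    rw [Finset.sum_eq_single (fun _ => false)]
    · rw [Finset.mul_sum]
      refine Finset.sum_congr rfl fun σ' _ => ?_
      have hmem : glue F₂ (fun _ => false) σ' ∈ Xᶜ := by
        rw [mem_compl_fib_conn_iff ends a₁ σ₁ h3]
        intro e he
        exact glue_apply_of_mem F₂ _ _ he
      rw [Set.indicator_of_mem hmem]
      simp only [Pi.one_apply, mul_one]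
      ring
    · intro σ _ hσ
      refine Finset.sum_eq_zero fun σ' _ => ?_
      have hnot : glue F₂ σ σ' ∉ Xᶜ := by
        rw [mem_compl_fib_conn_iff ends a₁ σ₁ h3]
        intro hall
        apply hσ
        funext i
        have := hall i i.2
        rwa [glue_apply_of_mem F₂ _ _ i.2] at this
      rw [Set.indicator_of_notMem hnot]
      ring
    · intro h
      exact absurd (Finset.mem_univ _) h
  -- `P(Xᶜ) = w(0)` (the raw identity at `v = 1`)
  have hP : prob p₂ Xᶜ = weight (fun i : {i // i ∈ F₂} => p₂ i) (fun _ => false) := by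
    have := raw (fun _ => 1)
    rw [prob_eq_expect_indicator]
    have h1 : (fun τ : {e // e ∉ awayEdges ends a₁} → Bool => (1 : R) * Xᶜ.indicator 1 τ) =
        Xᶜ.indicator 1 := by funext τ; rw [one_mul]
    rw [h1] at this
    rw [this]
    simp only [mul_one]
    rw [sum_weight, mul_one]
  -- `E[u ∘ clear] = ∑_{σ'} w(σ') u(glue 0 σ')`
  have hclear : expect p₂ (fun τ => u (clearInto ends a₁ C τ)) =
      ∑ σ' : {i // i ∉ F₂} → Bool, weight (fun i : {i // i ∉ F₂} => p₂ i) σ' *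
        u (glue F₂ (fun _ => false) σ') := by
    rw [expect_eq_sum_glue p₂ _ F₂]
    have hcg : ∀ (σ : {i // i ∈ F₂} → Bool) (σ' : {i // i ∉ F₂} → Bool),
        clearInto ends a₁ C (glue F₂ σ σ') = glue F₂ (fun _ => false) σ' := by
      intro σ σ'
      funext e
      unfold clearInto
      by_cases he : e ∈ F₂
      · rw [if_pos he, glue_apply_of_mem _ _ _ he]
      · rw [if_neg he, glue_apply_of_notMem _ _ _ he, glue_apply_of_notMem _ _ _ he]
    simp only [hcg]
    have hre : ∀ σ : {i // i ∈ F₂} → Bool, ∑ σ' : {i // i ∉ F₂} → Bool,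
        weight (fun i : {i // i ∈ F₂} => p₂ i) σ * weight (fun i : {i // i ∉ F₂} => p₂ i) σ' *
          u (glue F₂ (fun _ => false) σ') =
        weight (fun i : {i // i ∈ F₂} => p₂ i) σ *
          ∑ σ' : {i // i ∉ F₂} → Bool, weight (fun i : {i // i ∉ F₂} => p₂ i) σ' *
            u (glue F₂ (fun _ => false) σ') := by
      intro σ
      rw [Finset.mul_sum]
      refine Finset.sum_congr rfl fun σ' _ => ?_
      ring
    simp only [hre]
    rw [← Finset.sum_mul, sum_weight, one_mul]
  rw [raw u, hP, hclear]

/-- The fibre covariance of a monotone observable with `{a₁ ↔ a₃}` is `P(Xᶜ)·I_u(C'(a₃))`. -/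
lemma fib_cov_eq_fun (u : ({e // e ∉ awayEdges ends a₁} → Bool) → R)
    (σ₁ : {e // e ∈ awayEdges ends a₁} → Bool) {a₃ : V} (h3 : a₃ ≠ a₁) :
    expect (fun i : {e // e ∉ awayEdges ends a₁} => p i)
          (fun τ => u τ * (fib ends a₁ (connEvent ends a₁ a₃) σ₁).indicator 1 τ) -
        expect (fun i : {e // e ∉ awayEdges ends a₁} => p i) u *
          prob (fun i : {e // e ∉ awayEdges ends a₁} => p i) (fib ends a₁ (connEvent ends a₁ a₃) σ₁) =
      prob (fun i : {e // e ∉ awayEdges ends a₁} => p i) (fib ends a₁ (connEvent ends a₁ a₃) σ₁)ᶜ *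
        IpropF ends a₁ p u (cluster ends (baseConfig ends a₁ σ₁) a₃) := by
  unfold IpropF
  exact cov_eq_of_compl_factor (expect_mul_indicator_compl_eq ends a₁ p u σ₁ h3)

end Fun

end ZCDirect

end Summit.Ventures.PercRepro2
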